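import Summits.Ventures.QEC.Thresholds.HGPInstancesBoxThresholds
import Summits.Ventures.QEC.Thresholds.BBAnisotropicBounds
import Literature.InformationTheory.QuantumCodes.CSSPhenomenologicalDepolarizing
import HarnessLib

/-!
# Census CSS families under PHENOMENOLOGICAL DEPOLARIZING noise (three rates `p`, `q_X`, `q_Z`), sector-wise minimum-weight
# space-time decoding: certified region `p < (3/2)·p₀(w+1)`, `q_X, q_Z < p₀(w+1)`; toric hypergraph products
# `p ≤ .0151`, `q ≤ .0101`; `[[72,12,6]]` / `[[144,12,12]]` finite-size three-rate bounds — UNCONDITIONAL, kernel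

Venture QEC, `Summits/Ventures/QEC/Thresholds/` (LADDER-QEC rung Q5 × Q1, PARTITION row 09 "noise models: depolarising;
phenomenological"; qec-type-09 gen 5, item 09.PHDEPOL; companion of `ToricCodePhenomenologicalDepolarizing.lean`).
`CSSPhenomenologicalDepolarizing.lean` reduces the three-rate law (qubits depolarized at rate `p` per round, `X`-check
record wrong at `q_X`, `Z`-check record at `q_Z`) under sector-wise space-time decoding to the two one-sector two-rate
laws at `(2p/3, q_X)` and `(2p/3, q_Z)` (`CSSCode.depolPhenomFailureProb_le`, `CSSCode.depolPhenom_belowThreshold_of_boxes`).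
This file feeds it the census two-rate boxes:

| theorem | family / code | statement |
|---|---|---|
| `css_depolPhenom_belowThreshold_of_rowWeight` | any CSS family with `X`-checks of weight `≤ w_X`, `Z`-checks of weight `≤ w_Z`, sector distances `d_Z(i), d_X(i) ≥ 1`, subexponential space-time volume, ANY min-weight space-time decoders | `0 ≤ p < (3/2)·min(p₀(w_X+1), p₀(w_Z+1))`, `q_X < p₀(w_X+1)`, `q_Z < p₀(w_Z+1)` ⇒ `P_fail → 0` |
| `toricHGP_depolPhenom_belowThreshold`, `toricHGP_depolPhenom_belowThreshold_0151_0101` | toric codes as hypergraph products `HGP(circ_{k+2}, circ_{k+2})` | `p < (3/2)·p₀(5)`, `q_X, q_Z < p₀(5)`; decimals **`p ≤ .0151`, `q ≤ .0101`** |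
| `bb72_depolPhenomFailureProb_le`, `bb144_depolPhenomFailureProb_le` | Bravyi et al.'s `[[72,12,6]]`, `[[144,12,12]]` (KERNEL distances), `T` rounds | `2p/3, q_X, q_Z ≤ ρ ≤ 1/2`, `14√(ρ(1-ρ)) < 1` ⇒ **`P_fail ≤ 2·108T(196ρ(1-ρ))³/(7(1-14√(ρ(1-ρ))))`** resp. `2·216T(196ρ(1-ρ))⁶/(⋯)` |

All UNCONDITIONAL, tier CERTIFIED (kernel), axioms standard, 0 named facts; certified LOWER bounds on the threshold region
resp. rigorous UPPER bounds on failure (union bounds) for SECTOR-WISE (correlation-blind) minimum-weight space-time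
decoding (bivariate-bicycle sectors are not graphlike: the decoder class there is minimum-weight, not matching);
circuit-level noise is not this model; no Monte Carlo number is claimed. Theorem-only file.

## References

* [DennisEtAl2002] E. Dennis, A. Kitaev, A. Landahl, J. Preskill, J. Math. Phys. 43 (2002) 4452, arXiv:quant-ph/0110143,
  §4.1 (chunk p0012 L5–18: independent X/Z qubit errors — DKLP's own channel; q per syndrome bit; separate recovery of the
  two error types), §4.2, §5.3.
* [AliferisGottesmanPreskill2006] P. Aliferis, D. Gottesman, J. Preskill, QIC 6 (2006) 97, arXiv:quant-ph/0504218, §8.2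
  (chunk p0026 L11: the depolarizing channel, a Pauli chosen equiprobably from {X, Y, Z} — the tree's p/3 convention).
* [DumerKovalevPryadko2015] I. Dumer, A. A. Kovalev, L. P. Pryadko, PRL 115 (2015) 050502, Thm 3 with p. 5 (w → w + 2),
  eq. (succesful-decoding-depolarizing).
* [BravyiEtAl2024] S. Bravyi et al., Nature 627 (2024) 778, Table 1 (`[[72,12,6]]`, `[[144,12,12]]`).
-/

noncomputable section

namespace Summit.Ventures.QEC.Thresholds

open Filter Topology Finset Matrix
open Literature.InformationTheory.QuantumCodes

/-! ### Generic census CSS families -/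

section Family

variable {RX RZ Q : ℕ → Type*} [∀ i, Fintype (Q i)] [∀ i, DecidableEq (Q i)] [∀ i, Fintype (RX i)]
  [∀ i, DecidableEq (RX i)] [∀ i, Fintype (RZ i)] [∀ i, DecidableEq (RZ i)]

/-- **Census CSS families under phenomenological depolarizing noise**: `X`-checks of weight `≤ w_X`, `Z`-checks of weight
`≤ w_Z`, `Z`-logicals of weight `≥ d_Z(i) ≥ 1`, `X`-logicals of weight `≥ d_X(i) ≥ 1`, subexponential space-time volumes,
ANY minimum-weight space-time decoders of the two records; then every `0 ≤ p < (3/2)·min(p₀(w_X+1), p₀(w_Z+1))` (`p ≤ 1`),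
`0 ≤ q_X < p₀(w_X+1)`, `0 ≤ q_Z < p₀(w_Z+1)` is below threshold. UNCONDITIONAL.
[cite: DumerKovalevPryadko2015, Thm 3 with p. 5 (w → w + 2) and eq. (succesful-decoding-depolarizing)] -/
theorem css_depolPhenom_belowThreshold_of_rowWeight (C : ∀ i, CSSCode (RX i) (RZ i) (Q i)) (T : ℕ → ℕ)
    (DZ : ∀ i, CSSPhenom.STDecoder (RX i) (Q i) (T i)) (DX : ∀ i, CSSPhenom.STDecoder (RZ i) (Q i) (T i))
    (hDZ : ∀ i, (DZ i).IsMinWeight (CSSPhenom.stSyn (C i).HX (T i)) (CSSPhenom.stCycles (C i).HX (T i))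
      hammingNorm)
    (hDX : ∀ i, (DX i).IsMinWeight (CSSPhenom.stSyn (C i).HZ (T i)) (CSSPhenom.stCycles (C i).HZ (T i))
      hammingNorm)
    {wX wZ : ℕ} (hrowX : ∀ i x, (rowSupp (C i).HX x).card ≤ wX) (hrowZ : ∀ i x, (rowSupp (C i).HZ x).card ≤ wZ)
    (dZ dX : ℕ → ℕ) (hdZ1 : ∀ i, 1 ≤ dZ i) (hdX1 : ∀ i, 1 ≤ dX i)
    (hdZ : ∀ i (x : Q i → ZMod 2), (C i).HX *ᵥ x = 0 → x ∉ (C i).rowSpZ → dZ i ≤ hammingNorm x)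
    (hdX : ∀ i (x : Q i → ZMod 2), (C i).HZ *ᵥ x = 0 → x ∉ (C i).rowSpX → dX i ≤ hammingNorm x)
    (hgrowthZ : ∀ r : ℝ, 0 < r → r < 1 →
      Tendsto (fun i => (((Fintype.card (Q i) + Fintype.card (RX i)) * T i : ℕ) : ℝ) * r ^ dZ i) atTop (𝓝 0))
    (hgrowthX : ∀ r : ℝ, 0 < r → r < 1 →
      Tendsto (fun i => (((Fintype.card (Q i) + Fintype.card (RZ i)) * T i : ℕ) : ℝ) * r ^ dX i) atTop (𝓝 0))
    {p qX qZ : ℝ} (hp0 : 0 ≤ p) (hp1 : p ≤ 1)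
    (hp : p < 3 / 2 * min (thresholdValue ((wX + 1 : ℕ) : ℝ)) (thresholdValue ((wZ + 1 : ℕ) : ℝ)))
    (hqX0 : 0 ≤ qX) (hqX1 : qX ≤ 1) (hqX : qX < thresholdValue ((wX + 1 : ℕ) : ℝ))
    (hqZ0 : 0 ≤ qZ) (hqZ1 : qZ ≤ 1) (hqZ : qZ < thresholdValue ((wZ + 1 : ℕ) : ℝ)) :
    Tendsto (fun i => (C i).depolPhenomFailureProb (T i) (DZ i) (DX i) p qX qZ) atTop (𝓝 0) :=
  CSSCode.depolPhenom_belowThreshold_of_boxes C T DZ DX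
    (z_phenom_isThresholdBoxLowerBound_of_rowWeight C T DZ hDZ hrowX dZ hdZ1 hdZ hgrowthZ)
    (x_phenom_isThresholdBoxLowerBound_of_rowWeight C T DX hDX hrowZ dX hdX1 hdX hgrowthX)
    hp0 hp1 hp hqX0 hqX1 hqX hqZ0 hqZ1 hqZ

end Family

/-! ### Toric codes as hypergraph products -/

/-- **Toric codes `HGP(circ, circ)` under phenomenological depolarizing noise**: every poly-bounded schedule, ANY pair of
minimum-weight space-time decoder families: `0 ≤ p < (3/2)·p₀(5)`, `0 ≤ q_X, q_Z < p₀(5)` ⇒ `P_fail → 0`. UNCONDITIONAL.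
[cite: DumerKovalevPryadko2015, Thm 3 with p. 5 (w → w + 2, w = 4)] [cite: AliferisGottesmanPreskill2006, §8.2 (chunk p0026 L11: depolarizing channel)] -/
theorem toricHGP_depolPhenom_belowThreshold {T : ℕ → ℕ} (hT : ToricCode.IsPolyBounded T)
    (DZ DX : ∀ k, CSSPhenom.STDecoder (Fin (k + 2) × Fin (k + 2))
      ((Fin (k + 2) × Fin (k + 2)) ⊕ (Fin (k + 2) × Fin (k + 2))) (T k))
    (hDZ : ∀ k, (DZ k).IsMinWeight (CSSPhenom.stSyn (toricHGPCode k).HX (T k))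
      (CSSPhenom.stCycles (toricHGPCode k).HX (T k)) hammingNorm)
    (hDX : ∀ k, (DX k).IsMinWeight (CSSPhenom.stSyn (toricHGPCode k).HZ (T k))
      (CSSPhenom.stCycles (toricHGPCode k).HZ (T k)) hammingNorm)
    {p qX qZ : ℝ} (hp0 : 0 ≤ p) (hp : p < 3 / 2 * thresholdValue 5) (hqX0 : 0 ≤ qX) (hqX : qX < thresholdValue 5)
    (hqZ0 : 0 ≤ qZ) (hqZ : qZ < thresholdValue 5) :
    Tendsto (fun k => (toricHGPCode k).depolPhenomFailureProb (T k) (DZ k) (DX k) p qX qZ) atTop (𝓝 0) := by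
  have hv : thresholdValue (5 : ℝ) ≤ 1 / 2 := thresholdValue_le_half _
  exact CSSCode.depolPhenom_belowThreshold_of_box (fun k => toricHGPCode k) T DZ DX
    (toricHGP_z_phenom_isThresholdBoxLowerBound hT DZ hDZ) (toricHGP_x_phenom_isThresholdBoxLowerBound hT DX hDX)
    hp0 (by linarith) hp hqX0 (by linarith) hqX hqZ0 (by linarith) hqZ

/-- **Decimal form: `p ≤ .0151`, `q_X, q_Z ≤ .0101` ⇒ `P_fail → 0`** for the toric hypergraph-product codes under
phenomenological depolarizing noise, sector-wise minimum-weight space-time decoding — UNCONDITIONAL, kernel.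
[cite: DumerKovalevPryadko2015, Thm 3] [cite: DennisEtAl2002, §5.3 eq. (threshold_iso_num) (decimal box shape)] -/
theorem toricHGP_depolPhenom_belowThreshold_0151_0101 {T : ℕ → ℕ} (hT : ToricCode.IsPolyBounded T)
    (DZ DX : ∀ k, CSSPhenom.STDecoder (Fin (k + 2) × Fin (k + 2))
      ((Fin (k + 2) × Fin (k + 2)) ⊕ (Fin (k + 2) × Fin (k + 2))) (T k))
    (hDZ : ∀ k, (DZ k).IsMinWeight (CSSPhenom.stSyn (toricHGPCode k).HX (T k))
      (CSSPhenom.stCycles (toricHGPCode k).HX (T k)) hammingNorm)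
    (hDX : ∀ k, (DX k).IsMinWeight (CSSPhenom.stSyn (toricHGPCode k).HZ (T k))
      (CSSPhenom.stCycles (toricHGPCode k).HZ (T k)) hammingNorm)
    {p qX qZ : ℝ} (hp0 : 0 ≤ p) (hp : p ≤ 0.0151) (hqX0 : 0 ≤ qX) (hqX : qX ≤ 0.0101) (hqZ0 : 0 ≤ qZ)
    (hqZ : qZ ≤ 0.0101) :
    Tendsto (fun k => (toricHGPCode k).depolPhenomFailureProb (T k) (DZ k) (DX k) p qX qZ) atTop (𝓝 0) := by
  have h := thresholdValue_five_bounds.1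
  exact toricHGP_depolPhenom_belowThreshold hT DZ DX hDZ hDX hp0 (by linarith) hqX0 (by linarith) hqZ0 (by linarith)

/-! ### Bravyi et al.'s `[[72,12,6]]` and `[[144,12,12]]`: finite-size three-rate bounds -/

/-- **`[[72,12,6]]`, `T` rounds of phenomenological depolarizing noise** (depolarizing rate `p` with `2p/3 ≤ ρ`,
measurement rates `q_X, q_Z ≤ ρ ≤ 1/2`, `14√(ρ(1-ρ)) < 1`), ANY pair of minimum-weight space-time decoders:
`P_fail ≤ 2 · 108 T (196ρ(1-ρ))³ / (7(1 - 14√(ρ(1-ρ))))`. UNCONDITIONAL, kernel (distance `6` is the tree's KERNEL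
certificate `BB72_12_6_claim_holds`). [cite: DumerKovalevPryadko2015, Thm 3 with p. 5 and eq. (succesful-decoding-depolarizing)] [cite: BravyiEtAl2024, Table 1] -/
theorem bb72_depolPhenomFailureProb_le (T : ℕ)
    {DZ DX : CSSPhenom.STDecoder (BB.Mono 6 6) (BB.Mono 6 6 ⊕ BB.Mono 6 6) T}
    (hDZ : DZ.IsMinWeight (CSSPhenom.stSyn BB.bb72.HX T) (CSSPhenom.stCycles BB.bb72.HX T) hammingNorm)
    (hDX : DX.IsMinWeight (CSSPhenom.stSyn BB.bb72.HZ T) (CSSPhenom.stCycles BB.bb72.HZ T) hammingNorm)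
    {p qX qZ ρ : ℝ} (hp0 : 0 ≤ p) (hpρ : 2 * p / 3 ≤ ρ) (hqX0 : 0 ≤ qX) (hqXρ : qX ≤ ρ) (hqZ0 : 0 ≤ qZ)
    (hqZρ : qZ ≤ ρ) (hρ : ρ ≤ 1 / 2) (hr : 14 * Real.sqrt (ρ * (1 - ρ)) < 1) :
    BB.bb72.css.depolPhenomFailureProb T DZ DX p qX qZ ≤
      2 * (108 * T * (196 * (ρ * (1 - ρ))) ^ 3 / (7 * (1 - 14 * Real.sqrt (ρ * (1 - ρ))))) := by
  have hq0 : 0 ≤ 2 * p / 3 := by positivity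
  have hZ := bb72_zPhenomFailureProb_le_aniso T hDZ hq0 hqX0 hpρ hqXρ hρ hr
  have hX := bb72_xPhenomFailureProb_le_aniso T hDX hq0 hqZ0 hpρ hqZρ hρ hr
  have h := BB.bb72.css.depolPhenomFailureProb_le T DZ DX hp0 (by linarith) hqX0 (by linarith) hqZ0 (by linarith)
  rw [BB.Code.css_HX, BB.Code.css_HZ] at h
  linarith

/-- **`[[144,12,12]]`, `T` rounds of phenomenological depolarizing noise**, ANY pair of minimum-weight space-time
decoders (`2p/3, q_X, q_Z ≤ ρ ≤ 1/2`, `14√(ρ(1-ρ)) < 1`): `P_fail ≤ 2 · 216 T (196ρ(1-ρ))⁶ / (7(1 - 14√(ρ(1-ρ))))`.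
UNCONDITIONAL, kernel (distance `12` is the tree's KERNEL theorem `BB144_12_12_claim_holds`).
[cite: DumerKovalevPryadko2015, Thm 3 with p. 5 and eq. (succesful-decoding-depolarizing)] [cite: BravyiEtAl2024, Table 1] -/
theorem bb144_depolPhenomFailureProb_le (T : ℕ)
    {DZ DX : CSSPhenom.STDecoder (BB.Mono 12 6) (BB.Mono 12 6 ⊕ BB.Mono 12 6) T}
    (hDZ : DZ.IsMinWeight (CSSPhenom.stSyn BB.bb144.HX T) (CSSPhenom.stCycles BB.bb144.HX T) hammingNorm)
    (hDX : DX.IsMinWeight (CSSPhenom.stSyn BB.bb144.HZ T) (CSSPhenom.stCycles BB.bb144.HZ T) hammingNorm)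
    {p qX qZ ρ : ℝ} (hp0 : 0 ≤ p) (hpρ : 2 * p / 3 ≤ ρ) (hqX0 : 0 ≤ qX) (hqXρ : qX ≤ ρ) (hqZ0 : 0 ≤ qZ)
    (hqZρ : qZ ≤ ρ) (hρ : ρ ≤ 1 / 2) (hr : 14 * Real.sqrt (ρ * (1 - ρ)) < 1) :
    BB.bb144.css.depolPhenomFailureProb T DZ DX p qX qZ ≤
      2 * (216 * T * (196 * (ρ * (1 - ρ))) ^ 6 / (7 * (1 - 14 * Real.sqrt (ρ * (1 - ρ))))) := by
  have hq0 : 0 ≤ 2 * p / 3 := by positivity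
  have hZ := bb144_zPhenomFailureProb_le_aniso T hDZ hq0 hqX0 hpρ hqXρ hρ hr
  have hX := bb144_xPhenomFailureProb_le_aniso T hDX hq0 hqZ0 hpρ hqZρ hρ hr
  have h := BB.bb144.css.depolPhenomFailureProb_le T DZ DX hp0 (by linarith) hqX0 (by linarith) hqZ0 (by linarith)
  rw [BB.Code.css_HX, BB.Code.css_HZ] at h
  linarith

end Summit.Ventures.QEC.Thresholds

end
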